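import Summits.QuantumAdvantage.AdviceFreeQNC0.WalkExactLaw
import HarnessLib

/-!
# Cell qa-qnc0 (rung F-Q1, route RingFrame, crux α `RingToElim`): the path characters form a
# basis — the inversion formula `h = Σ_a L_a(h)·χ_a`

Completion of the `𝔽₄`-character toolkit of `WalkCharacters.lean` / `WalkExactLaw.lean`
(planner qa-qnc0-p1 TARGET §15.1: "{χ_a} is a basis of 𝔽₄^{{0,1}ⁿ}", "the coefficient functional
is f̂(a) = Σ_u f(u)·ω^{−a·ū}"):

* `sum_chi_mul_weight` — the kernel identity `Σ_a χ_a(u)·Πᵢ ω^{−aᵢ(1−u'ᵢ)} = [u = u']`;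
* `sum_Lfun_mul_chi` — INVERSION: `Σ_a L_a(h)·χ_a(u) = h(u)` for every `h : {0,1}^m → 𝔽₄`;
* `eq_zero_of_forall_Lfun_eq_zero` — hence `L_a(h) = 0` for all `a` forces `h = 0` (the `2^m`
  characters span, and by `Lfun_chi` they are independent: a basis).

With `Lfun_tr_eq_zero_of_far` (`WalkFailFloor.lean`) this is the dictionary behind TARGET §15.5
("the full win code is `{h : ĥ = 0 on FAR_D}`", `⊆` direction in the kernel).  Standard character
calculus; the cell's lemmas (prover qn-prover-3 gen 5), 2026-08-27.  WHAT THIS IS NOT: the `⊇`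
direction of §15.5 and everything quantitative are untouched; no separation claim.
-/

noncomputable section

namespace Summit.QuantumAdvantage.AdviceFreeQNC0

open Finset
open Literature.Computability.MetaComplexity Literature.Computability.MetaComplexity.Smolensky
open F4

variable {m : ℕ}

/-- **The kernel identity**: `Σ_a χ_a(u)·Πᵢ (u'ᵢ ? 1 : ω^{letter ¬aᵢ}) = [u = u']`. [folklore] -/
theorem sum_chi_mul_weight (u u' : Fin m → Bool) :
    ∑ a : Fin m → Bool, chi a u * ∏ i, (if u' i then (1 : F4) else ω ^ lett (!a i)) =
      if u = u' then 1 else 0 := by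
  classical
  unfold chi
  have e : ∀ a : Fin m → Bool,
      (∏ i, (if u i = true then ω ^ lett (a i) else 1)) * ∏ i, (if u' i = true then (1 : F4) else ω ^ lett (!a i)) =
        ∏ i, ((if u i = true then ω ^ lett (a i) else 1) * (if u' i = true then (1 : F4) else ω ^ lett (!a i))) := by
    intro a; rw [← Finset.prod_mul_distrib]
  rw [Finset.sum_congr rfl fun a _ => e a]
  have h := Finset.prod_univ_sum (fun _ : Fin m => (univ : Finset Bool))
    (fun i c => (if u i = true then ω ^ lett c else 1) * (if u' i = true then (1 : F4) else ω ^ lett (!c)))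
  rw [Fintype.piFinset_univ] at h
  rw [← h]
  have hfac : ∀ i, (∑ c : Bool, (if u i = true then ω ^ lett c else 1) *
      (if u' i = true then (1 : F4) else ω ^ lett (!c))) = if u i = u' i then 1 else 0 := by
    intro i
    rw [Fintype.sum_bool]
    unfold lett
    cases u i <;> cases u' i <;> simp [omega_add_omega_sq, add_self, add_comm]
    · -- `u i = true`, `u' i = false`: `ω·ω² + ω²·ω = 0`
      rw [mul_comm (ω ^ 2) ω, add_self]
  simp_rw [hfac]
  by_cases huu : u = u'
  · subst huu; simp
  · rw [if_neg huu]
    obtain ⟨i, hi⟩ : ∃ i, u i ≠ u' i := Function.ne_iff.mp huu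
    exact Finset.prod_eq_zero (Finset.mem_univ i) (if_neg hi)

/-- **INVERSION**: `Σ_a L_a(h)·χ_a(u) = h(u)` — the characters `χ_a` span `𝔽₄^{{0,1}^m}` with
coefficient functionals `L_a`. [folklore] -/
theorem sum_Lfun_mul_chi (h : (Fin m → Bool) → F4) (u : Fin m → Bool) :
    ∑ a : Fin m → Bool, Lfun a h * chi a u = h u := by
  classical
  unfold Lfun
  have e : ∀ a : Fin m → Bool,
      (∑ u', h u' * ∏ i, (if u' i = true then (1 : F4) else ω ^ lett (!a i))) * chi a u =
        ∑ u', h u' * (chi a u * ∏ i, (if u' i = true then (1 : F4) else ω ^ lett (!a i))) := by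
    intro a
    rw [Finset.sum_mul]
    exact Finset.sum_congr rfl fun u' _ => by ring
  rw [Finset.sum_congr rfl fun a _ => e a, Finset.sum_comm]
  have e2 : ∀ u' : Fin m → Bool,
      ∑ a : Fin m → Bool, h u' * (chi a u * ∏ i, (if u' i = true then (1 : F4) else ω ^ lett (!a i))) =
        h u' * (if u = u' then 1 else 0) := by
    intro u'
    rw [← Finset.mul_sum, sum_chi_mul_weight]
  rw [Finset.sum_congr rfl fun u' _ => e2 u']
  simp

/-- **The characters are a basis**: if every coefficient `L_a(h)` vanishes then `h = 0`. [folklore] -/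
theorem eq_zero_of_forall_Lfun_eq_zero {h : (Fin m → Bool) → F4} (hL : ∀ a, Lfun a h = 0) : h = 0 := by
  funext u
  rw [← sum_Lfun_mul_chi h u]
  simp [hL]

end Summit.QuantumAdvantage.AdviceFreeQNC0

end
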